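import Summits.CriticalPhenomena.PercolationContinuityZ3.Theorems.PercNearOneGluingNoHeavyLowerTailKnQuestion8CoefficientwiseTrivialCore
import Summits.CriticalPhenomena.PercolationContinuityZ3.Theorems.PercNearOneGluingNoHeavyLowerTailKnQuestion8CoefficientwiseGluing
import HarnessLib

/-!
# THEOREM X-APEX: the coefficientwise first rung CW-PA(z) holds whenever `x` is joined to every other vertex (prim-lf-2 gen 31)

Support file (`--supports stmt-CriticalPhenomena-4575`, closed), prover `prim-lf-2` (gen 31).  No definitions, no named facts, no sorries; standard axioms.
Memo `prim-lf-2/CW-BLOCKS-gen31.md` §3 (the `x ↔ z` mirror of THEOREM APEX); the engine is prim-cplus-coupling's THEOREM TC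
(`Coefficientwise.grand_trivialCore_nonneg`, …CoefficientwiseTrivialCore: conjecture GRAND, hence CW-PA, holds on the colourings whose two `z`-clusters
meet only in `z`).

Setting (prim-lf-2's `Coefficientwise` files): a finite multigraph `ends : ι → Sym2 V` with edge set `E`, terminals `x ≠ z`, colourings `s ⊆ E` (red) /
`E \ s` (blue), `C_v(s) = openCluster (ends '' s) v`; the wall is `{z ∉ C_x(s)} ∩ {z ∉ C_x(E \ s)}` ('no monochromatic `x–z` path').
* `Coefficientwise.trivialCore_of_wall_of_xAdj` — if every vertex `y ∉ {x, z}` lying in both `z`-clusters of some colouring is joined to `x` by an edge,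
  then on the wall the two clusters of `z` meet only in `z` (such a `y` would put `x` into a `z`-cluster through the edge `xy`, i.e. `z` into an `x`-cluster).
* `Coefficientwise.cwpa_of_zCore_adj` — hence CW-PA(z): `0 ≤ Σ_{wall} (f(C_x s) − f(C_x(E∖s)))(g(C_x s) − g(C_x(E∖s)))` for monotone `f, g`, whenever every
  vertex that can lie in both `z`-clusters (equivalently: is 2-edge-connected to `z` in `G − x`) is adjacent to `x` — e.g. `G − x` a forest with `x` attached
  anywhere; the `x ↔ z` mirror of `cwpa_of_doublyReachable_adj`.
* `Coefficientwise.cwpa_xapex` — **THEOREM X-APEX**: CW-PA(z) for every multigraph in which `x` is joined to every vertex other than `z` that is met by an edge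
  (cones with apex `x` over arbitrary multigraphs, `z` attached anywhere; wheels with hub `x`); the mirror of `cwpa_apex`.
All decidability is classical.
[cite: KozmaNitzan2024, Questions 8–9 (§5.5 p. 36) (context: first rung of the coefficientwise programme for Question 8)]
-/

namespace Summit.CriticalPhenomena.PercolationContinuityZ3.Theorems

open Finset Literature.Probability.Percolation

namespace Coefficientwise

variable {ι V : Type*} (ends : ι → Sym2 V)

open Classical in
/-- On the wall, a vertex lying in both `z`-clusters is never adjacent to `x`: if `y ∈ C_z(s) ∩ C_z(E \ s)`, `y ≠ z`, and some edge of `E` is `{x, y}`,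
then `z ∈ C_x(s)` or `z ∈ C_x(E \ s)`.  Hence, if every such `y` is adjacent to `x`, wall colourings have trivial core.
[cite: KozmaNitzan2024, §5.5 (context only; folklore)] -/
theorem trivialCore_of_wall_of_xAdj (E : Finset ι) (x z : V) {s : Finset ι}
    (hadj : ∀ y, y ≠ z → y ∈ openCluster (ends '' (↑s : Set ι)) z → y ∈ openCluster (ends '' (↑(E \ s) : Set ι)) z →
      y = x ∨ ∃ j ∈ E, ends j = s(x, y))
    (hzK : z ∉ openCluster (ends '' (↑s : Set ι)) x) (hzL : z ∉ openCluster (ends '' (↑(E \ s) : Set ι)) x) :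
    ∀ y, y ∈ openCluster (ends '' (↑s : Set ι)) z → y ∈ openCluster (ends '' (↑(E \ s) : Set ι)) z → y = z := by
  intro y hyR hyB
  by_contra hyz
  rcases hadj y hyz hyR hyB with rfl | ⟨j, hjE, hj⟩
  · -- `y = x`: then `z ∈ C_x(s)` by symmetry of reachability
    exact hzK ((mem_openCluster_comm ends s z y).mp hyR)
  · by_cases hjs : j ∈ s
    · -- the edge `xy` is red: `x ∈ C_z(s)`, so `z ∈ C_x(s)`
      have hx : x ∈ openCluster (ends '' (↑s : Set ι)) z :=
        mem_openCluster_of_edge ends hjs (by rw [hj, Sym2.eq_swap]) hyR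
      exact hzK ((mem_openCluster_comm ends s z x).mp hx)
    · have hjb : j ∈ E \ s := Finset.mem_sdiff.mpr ⟨hjE, hjs⟩
      have hx : x ∈ openCluster (ends '' (↑(E \ s) : Set ι)) z :=
        mem_openCluster_of_edge ends hjb (by rw [hj, Sym2.eq_swap]) hyB
      exact hzL ((mem_openCluster_comm ends (E \ s) z x).mp hx)

open Classical in
/-- **CW-PA(z) when every possible core vertex of `z` is adjacent to `x`** (prim-lf-2 gen 31; the `x ↔ z` mirror of `cwpa_of_doublyReachable_adj`).
If every `y ∉ {x, z}` that lies in both `z`-clusters of some colouring of `E` is joined to `x` by an edge of `E`, then for all monotone `f, g`: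
`0 ≤ Σ_{s ⊆ E : z ∉ C_x(s), z ∉ C_x(E∖s)} (f(C_x s) − f(C_x(E∖s)))·(g(C_x s) − g(C_x(E∖s)))`.  Proof: by `trivialCore_of_wall_of_xAdj` the wall lies in the
trivial-core stratum of `z`, where prim-cplus-coupling's THEOREM TC (`grand_trivialCore_nonneg`, with `w = 1` and test functions `f(K)`, `g(K)`) applies.
[cite: KozmaNitzan2024, Questions 8–9 (§5.5 p. 36) (context)] -/
theorem cwpa_of_zCore_adj (E : Finset ι) (x z : V) (Vf : Finset V) (hVf : ∀ i ∈ E, ∀ y ∈ ends i, y ∈ Vf)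
    (hadj : ∀ s, s ⊆ E → ∀ y, y ≠ x → y ≠ z → y ∈ openCluster (ends '' (↑s : Set ι)) z →
      y ∈ openCluster (ends '' (↑(E \ s) : Set ι)) z → ∃ j ∈ E, ends j = s(x, y))
    (f g : Set V → ℝ) (hf : Monotone f) (hg : Monotone g) :
    0 ≤ ∑ s ∈ E.powerset.filter (fun s : Finset ι => z ∉ openCluster (ends '' (↑s : Set ι)) x ∧ z ∉ openCluster (ends '' (↑(E \ s) : Set ι)) x),
      (f (openCluster (ends '' (↑s : Set ι)) x) - f (openCluster (ends '' (↑(E \ s) : Set ι)) x)) *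
        (g (openCluster (ends '' (↑s : Set ι)) x) - g (openCluster (ends '' (↑(E \ s) : Set ι)) x)) := by
  have key := grand_trivialCore_nonneg ends E x z Vf hVf (fun _ => (1 : ℝ)) (fun _ => zero_le_one)
    (fun a _ _ _ _ => f a) (fun a _ _ _ _ => g a)
    (fun a a' b c d u h => hf h) (fun a b b' c d u _ => le_rfl) (fun a b c c' d u _ => le_rfl) (fun a b c d d' u _ => le_rfl)
    (fun a a' b c d u h => hg h) (fun a b b' c d u _ => le_rfl) (fun a b c c' d u _ => le_rfl) (fun a b c d d' u _ => le_rfl)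
  simp only [one_mul] at key
  refine key.trans_eq (Finset.sum_congr ?_ fun _ _ => rfl)
  refine Finset.filter_congr fun s hs => ?_
  rw [Finset.mem_powerset] at hs
  constructor
  · rintro ⟨-, hzK, hzL⟩
    exact ⟨hzK, hzL⟩
  · rintro ⟨hzK, hzL⟩
    refine ⟨trivialCore_of_wall_of_xAdj ends E x z (fun y hyz hyR hyB => ?_) hzK hzL, hzK, hzL⟩
    by_cases hyx : y = x
    · exact Or.inl hyx
    · exact Or.inr (hadj s hs y hyx hyz hyR hyB)

open Classical in
/-- **THEOREM X-APEX** (prim-lf-2 gen 31, memo `CW-BLOCKS-gen31.md` §3; the `x ↔ z` mirror of THEOREM APEX).  If every vertex `v ∉ {x, z}` met by an edge of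
`E` is joined to `x` by an edge of `E` (cones with apex `x` over arbitrary multigraphs, with the conditioning vertex `z` attached anywhere), then the
coefficientwise first rung CW-PA(z) holds for all monotone `f, g`:
`0 ≤ Σ_{s ⊆ E : z ∉ C_x(s), z ∉ C_x(E∖s)} (f(C_x s) − f(C_x(E∖s)))·(g(C_x s) − g(C_x(E∖s)))`.
[cite: KozmaNitzan2024, Questions 8–9 (§5.5 p. 36) (context)] -/
theorem cwpa_xapex (E : Finset ι) (x z : V) (Vf : Finset V) (hVf : ∀ i ∈ E, ∀ y ∈ ends i, y ∈ Vf)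
    (hapex : ∀ i ∈ E, ∀ v ∈ ends i, v ≠ x → v ≠ z → ∃ j ∈ E, ends j = s(x, v))
    (f g : Set V → ℝ) (hf : Monotone f) (hg : Monotone g) :
    0 ≤ ∑ s ∈ E.powerset.filter (fun s : Finset ι => z ∉ openCluster (ends '' (↑s : Set ι)) x ∧ z ∉ openCluster (ends '' (↑(E \ s) : Set ι)) x),
      (f (openCluster (ends '' (↑s : Set ι)) x) - f (openCluster (ends '' (↑(E \ s) : Set ι)) x)) *
        (g (openCluster (ends '' (↑s : Set ι)) x) - g (openCluster (ends '' (↑(E \ s) : Set ι)) x)) := by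
  refine cwpa_of_zCore_adj ends E x z Vf hVf ?_ f g hf hg
  intro s hs y hyx hyz hyR _
  obtain ⟨i, hi, hyi⟩ := exists_edge_of_mem_openCluster ends hyR hyz
  exact hapex i (hs hi) y hyi hyx hyz

end Coefficientwise

end Summit.CriticalPhenomena.PercolationContinuityZ3.Theorems
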